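import Summits.BirchSwinnertonDyer.BirchSwinnertonDyer.Theorems.ByReductionTypeAtTwoAdditiveKatoTransportPrintExactAnyImageDecomposition
import Summits.BirchSwinnertonDyer.BirchSwinnertonDyer.Theorems.ByReductionTypeAtTwoAdditiveKatoTransportIsogenyDoors
import HarnessLib

/-!
# Route ByReductionTypeAtTwo, crux C4″ `AdditivePotMultOverKAtTwo` (stmt-BirchSwinnertonDyer-22618; parent
# `AdditiveRankZeroAtTwo` 19098) — R16, part 6: the decomposition doors AT THE MEMBER — Kato's divisibility
# `ℓ_𝔮(X(W₁/ℚ_∞)) ≤ ℓ_𝔮(Λ/(L̃))` at EVERY height-one `𝔮 ∌ 2` for EVERY curve `W₁` isogenous over `ℚ` to the additive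
# split-twist curve `W` (Kato's member `W_K` included), blocks (−1)/(−2), key `γ`, ANY image of `ρ̄`, functional equation in
# the kernel, `ι`-symmetry BY NAME from Greenberg's Thm. 1.14 ×2 (PRINT) + the decomposition reading `hdec` (theorems only)

Cell `bsd-2adic`, seat `bsd-2adic-k4-w3` GEN 4. Composition of `…PrintExactAnyImageDecomposition.lean` (the decomposition
doors for the ONE image-free input, p701753) with `…KatoTransportIsogenyDoors.lean` (`lengthAt_selmerDual_eq_of_isIsogenous`:
dual Selmer lengths at `𝔮 ∌ p` are isogeny invariants, p701368). This is the exact socket of R14 (c) for the REDUCIBLE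
split-twist blocks: Kato's member package (`Kato2004.MemberHullInputs`, readings R1–R13/R12♯) lives at the member `W_K ∼ W`, and
its one twist-sensitive field at the exceptional prime `𝔮₀` is read off the `X`-currency divisibility delivered here at `W_K`
from {ONE input `KatoOddBranchInputsAtTwoNeg{One,Two}SplitTwistPrintExactAnyImage`, `Kato2004.thm12_4` PRINT, Greenberg
1.14 ×2 PRINT, `hdec` (t42 GEN 23's lane), torsion of the twist's duals}. HONEST FRAMING (D-0036 / D-0054): theorems only —
no definition, no named fact, no instance, no `sorry`; route-independent; conditional on the named inputs exactly as the
doors composed; types-the-object-of; closes none; nothing booked; BSD is not proved by any of this. PARTITION: X5@2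
additive potentially-multiplicative block, the four split-twist sub-blocks × `p = 2`.

References: [Kato2004Asterisque] §8.3 (p. 181), Thm. 12.4 (2) (p. 221), Thm. 12.5 (3) with (12.5.1) (p. 222), §17.13
(pp. 279–280); [GreenbergLNM1716] Thm. 1.14 (p. 68), §4 (p. 107); [GreenbergVatsal2000] §2 p. 28; [MazurTateTeitelbaum1986Invent]
§I.17; memo `run/shared/lean/pub/bsd-2adic/k4w3/gen4/VERDICT-22618-k4w3-GEN4.md`.
-/

set_option autoImplicit false
-- the summit's namespace `Summit.BirchSwinnertonDyer.BirchSwinnertonDyer` (Sub = Summit) trips `dupNamespace`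
set_option linter.dupNamespace false

noncomputable section

open scoped Classical MatrixGroups ModularForm NumberField

open Field CongruenceSubgroup WeierstrassCurve IsDedekindDomain Literature.NumberTheory.EllipticCurves
  Literature.NumberTheory.EllipticCurves.ModularForms Literature.NumberTheory.EllipticCurves.IwasawaAlgebra
  Literature.NumberTheory.EllipticCurves.Module

namespace Summit.BirchSwinnertonDyer.BirchSwinnertonDyer.Theorems.AddKatoTwo

/-- **Member decomposition door, (−1)-block, key `γ`, ANY image.** For `W` globally minimal, additive with `W^{(−1)}` split
multiplicative at `2`, the decomposition data of `lengthAt_selmerDual_le_of_oddBranchInputsPrintExactAnyImage_of_decomposition_fe`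
(model `W'` of the twist, field `F`, torsion finitely generated duals `D_F`, `D'`, the reading `hdec` for the key-`γ` datum `D`
of `W`), an integral multiple `L̃ = 2^m·L⁻ ≠ 0`, and ANY `W₁ ∼_ℚ W` with key-`γ` datum `D₁`:
`ℓ_𝔮(D₁.X) ≤ ℓ_𝔮(Λ/(L̃))` at every height-one `𝔮 ∌ 2`, from `Kato2004.thm12_4`, the ONE image-free input and Greenberg's
Thm. 1.14 ×2 by name. [cite: Kato2004Asterisque, §8.3 (p. 181), Thm. 12.4 (2) (p. 221), Thm. 12.5 (3) and (12.5.1) (p. 222), §17.13 (pp. 279–280)]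
[cite: GreenbergLNM1716, Thm. 1.14 (p. 68), §4 (p. 107)] [cite: GreenbergVatsal2000, §2 (p. 28)] [cite: MazurTateTeitelbaum1986Invent, §I.17] -/
theorem lengthAt_selmerDual_le_of_oddBranchInputsPrintExactAnyImage_of_decomposition_fe_of_isIsogenous
    (h12 : Kato2004.thm12_4) (hPE : KatoOddBranchInputsAtTwoNegOneSplitTwistPrintExactAnyImage)
    (h114 : Greenberg1999_thm114_charIdeal_iota_invariant)
    (h114F : Greenberg1999.thm114_charIdeal_iota_invariant_splitMult_baseChange)
    (W : WeierstrassCurve ℚ) [W.IsElliptic] [W.IsGloballyMinimal] [ContinuousSMul ℤ_[2] (W.tateModule 2)]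
    {N : ℕ} [NeZero N] (f : CuspForm (Gamma0 N) 2) (κ : ZpExtension ℚ 2) (γ : absoluteGaloisGroup ℚ)
    (hsp : (W.quadraticTwist (-1)).HasSplitMultiplicativeReductionAtPrime 2)
    (hκ : κ.IsCyclotomic) (hγ : κ.IsTopGenerator γ)
    (hγ' : IsCyclotomicVariable 2 γ) (hf : IsNewformOf (W.quadraticTwist (-1)) f)
    (I : Kato2004.IwasawaH1Data W 2 κ γ) (D : W.SelmerDualData κ γ)
    (W' : WeierstrassCurve ℚ) [W'.IsElliptic] [W'.IsGloballyMinimal] (hmult' : W'.HasMultiplicativeReductionAtPrime 2)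
    (F : Type) [Field F] [NumberField F]
    (hF : ∀ v : HeightOneSpectrum (𝓞 F), (2 : 𝓞 F) ∈ v.asIdeal → (W'.baseChange F).HasSplitMultiplicativeReductionAt v)
    (κF : ZpExtension F 2) (γF : Field.absoluteGaloisGroup F) (hκF : κF.IsCyclotomic) (hγF : κF.IsTopGenerator γF)
    (DF : (W'.baseChange F).SelmerDualData κF γF) [Module.Finite (IwasawaAlgebra 2) DF.X] (hDF : DF.IsTorsion)
    (D' : W'.SelmerDualData κ γ) [Module.Finite (IwasawaAlgebra 2) D'.X] (hD' : D'.IsTorsion)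
    (hdec : ∀ 𝔮 : PrimeSpectrum (IwasawaAlgebra 2), 𝔮.asIdeal.height = 1 →
      PowerSeries.C (2 : ℤ_[2]) ∉ 𝔮.asIdeal →
      lengthAt (IwasawaAlgebra 2) DF.X 𝔮 = lengthAt (IwasawaAlgebra 2) D'.X 𝔮 + lengthAt (IwasawaAlgebra 2) D.X 𝔮)
    (Lt : IwasawaAlgebra 2) (m : ℕ)
    (hLt : iwasawaToPowerSeries 2 Lt =
      PowerSeries.C ((2 : ℚ_[2]) ^ m) * padicLFunctionMinusBranchMult f (1 : ℚ_[2]) 1)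
    (hLt0 : Lt ≠ 0)
    (W₁ : WeierstrassCurve ℚ) [W₁.IsElliptic] (hiso : IsIsogenous W W₁) (D₁ : W₁.SelmerDualData κ γ)
    (𝔮 : PrimeSpectrum (IwasawaAlgebra 2)) (h𝔮 : 𝔮.asIdeal.height = 1)
    (hp𝔮 : PowerSeries.C (2 : ℤ_[2]) ∉ 𝔮.asIdeal) :
    lengthAt (IwasawaAlgebra 2) D₁.X 𝔮 ≤
      lengthAt (IwasawaAlgebra 2) (IwasawaAlgebra 2 ⧸ Ideal.span {Lt}) 𝔮 := by
  have hp𝔮' : PowerSeries.C ((2 : ℕ) : ℤ_[2]) ∉ 𝔮.asIdeal := by exact_mod_cast hp𝔮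
  rw [← lengthAt_selmerDual_eq_of_isIsogenous hiso D D₁ 𝔮 hp𝔮']
  exact lengthAt_selmerDual_le_of_oddBranchInputsPrintExactAnyImage_of_decomposition_fe h12 hPE h114 h114F W f κ γ hsp hκ
    hγ hγ' hf I D W' hmult' F hF κF γF hκF hγF DF hDF D' hD' hdec Lt m hLt hLt0 𝔮 h𝔮 hp𝔮

/-- **Member decomposition door, (−2)-block, key `γ`, ANY image** — the twin for `W` with `W^{(−2)}` split multiplicative at
`2` (model `W'` of the twist by `−2`, intended `F = ℚ(√−2)`, the image-free `(−2)` input — a THEOREM modulo the `(−1)` one by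
R15 — and an integral multiple of the `ω·χ₂`-branch), for ANY `W₁ ∼_ℚ W`.
[cite: Kato2004Asterisque, §8.3 (p. 181), Thm. 12.4 (2) (p. 221), Thm. 12.5 (3) and (12.5.1) (p. 222), §17.13 (pp. 279–280)]
[cite: GreenbergLNM1716, Thm. 1.14 (p. 68), §4 (p. 107)] [cite: GreenbergVatsal2000, §2 (p. 28)] [cite: MazurTateTeitelbaum1986Invent, §I.17] -/
theorem lengthAt_selmerDual_le_of_oddBranchInputsNegTwoPrintExactAnyImage_of_decomposition_fe_of_isIsogenous
    (h12 : Kato2004.thm12_4) (hPE : KatoOddBranchInputsAtTwoNegTwoSplitTwistPrintExactAnyImage)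
    (h114 : Greenberg1999_thm114_charIdeal_iota_invariant)
    (h114F : Greenberg1999.thm114_charIdeal_iota_invariant_splitMult_baseChange)
    (W : WeierstrassCurve ℚ) [W.IsElliptic] [W.IsGloballyMinimal] [ContinuousSMul ℤ_[2] (W.tateModule 2)]
    {N : ℕ} [NeZero N] (f : CuspForm (Gamma0 N) 2) (κ : ZpExtension ℚ 2) (γ : absoluteGaloisGroup ℚ)
    (hsp : (W.quadraticTwist (-2)).HasSplitMultiplicativeReductionAtPrime 2)
    (hκ : κ.IsCyclotomic) (hγ : κ.IsTopGenerator γ)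
    (hγ' : IsCyclotomicVariable 2 γ) (hf : IsNewformOf (W.quadraticTwist (-2)) f)
    (I : Kato2004.IwasawaH1Data W 2 κ γ) (D : W.SelmerDualData κ γ)
    (W' : WeierstrassCurve ℚ) [W'.IsElliptic] [W'.IsGloballyMinimal] (hmult' : W'.HasMultiplicativeReductionAtPrime 2)
    (F : Type) [Field F] [NumberField F]
    (hF : ∀ v : HeightOneSpectrum (𝓞 F), (2 : 𝓞 F) ∈ v.asIdeal → (W'.baseChange F).HasSplitMultiplicativeReductionAt v)
    (κF : ZpExtension F 2) (γF : Field.absoluteGaloisGroup F) (hκF : κF.IsCyclotomic) (hγF : κF.IsTopGenerator γF)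
    (DF : (W'.baseChange F).SelmerDualData κF γF) [Module.Finite (IwasawaAlgebra 2) DF.X] (hDF : DF.IsTorsion)
    (D' : W'.SelmerDualData κ γ) [Module.Finite (IwasawaAlgebra 2) D'.X] (hD' : D'.IsTorsion)
    (hdec : ∀ 𝔮 : PrimeSpectrum (IwasawaAlgebra 2), 𝔮.asIdeal.height = 1 →
      PowerSeries.C (2 : ℤ_[2]) ∉ 𝔮.asIdeal →
      lengthAt (IwasawaAlgebra 2) DF.X 𝔮 = lengthAt (IwasawaAlgebra 2) D'.X 𝔮 + lengthAt (IwasawaAlgebra 2) D.X 𝔮)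
    (Lt : IwasawaAlgebra 2) (m : ℕ)
    (hLt : iwasawaToPowerSeries 2 Lt =
      PowerSeries.C ((2 : ℚ_[2]) ^ m) * padicLFunctionMinusBranchMultTwist f (1 : ℚ_[2]) 1 (-1))
    (hLt0 : Lt ≠ 0)
    (W₁ : WeierstrassCurve ℚ) [W₁.IsElliptic] (hiso : IsIsogenous W W₁) (D₁ : W₁.SelmerDualData κ γ)
    (𝔮 : PrimeSpectrum (IwasawaAlgebra 2)) (h𝔮 : 𝔮.asIdeal.height = 1)
    (hp𝔮 : PowerSeries.C (2 : ℤ_[2]) ∉ 𝔮.asIdeal) :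
    lengthAt (IwasawaAlgebra 2) D₁.X 𝔮 ≤
      lengthAt (IwasawaAlgebra 2) (IwasawaAlgebra 2 ⧸ Ideal.span {Lt}) 𝔮 := by
  have hp𝔮' : PowerSeries.C ((2 : ℕ) : ℤ_[2]) ∉ 𝔮.asIdeal := by exact_mod_cast hp𝔮
  rw [← lengthAt_selmerDual_eq_of_isIsogenous hiso D D₁ 𝔮 hp𝔮']
  exact lengthAt_selmerDual_le_of_oddBranchInputsNegTwoPrintExactAnyImage_of_decomposition_fe h12 hPE h114 h114F W f κ γ
    hsp hκ hγ hγ' hf I D W' hmult' F hF κF γF hκF hγF DF hDF D' hD' hdec Lt m hLt hLt0 𝔮 h𝔮 hp𝔮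

end Summit.BirchSwinnertonDyer.BirchSwinnertonDyer.Theorems.AddKatoTwo

end
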